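/-
Copyright (c) 2026. All rights reserved.
Released under Apache 2.0 license as described in the file LICENSE.
-/
import Literature.Geometry.Kaehler.ComplexTorusQuaternionXSixSpecialCyclesDegreeStructure
import HarnessLib

/-!
# The degrees `deg Z(t)_ℚ` on `X₆` at `t = 4, 9, 12, 24, 36, 100` (the ramified primes), and the eighteen values

The sibling file `…XSixSpecialCyclesDegree` proved Kudla–Rapoport–Yang's identity (3.4.14) = (3.4.4)·(3.4.6),
`2·Σᶠ_{[x] ∈ L(t)/O₆^×} e_x⁻¹ = 2·δ(d, 6)·Σ_{c ∣ n, (c,6)=1} h(−c²d)/w(−c²d)` (`4t = n²d`, `B = (−1,3)_ℚ`, `D(B) = 6`), for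
the twelve values `t = 1, 2, 3, 6, 7, 10, 13, 19, 21, 22, 25, 75`, with both sides genuine functions of the tree's objects but
the right side left UNEVALUATED in the statements. `…XSixSpecialCyclesDegreeStructure` then proved, for every `t`, that
NEITHER side changes under `t ↦ 4t` (`n ↦ 2n`) and `t ↦ 9t` (`n ↦ 3n`): `Σᶠ_{L(4t)/O₆^×} e⁻¹ = Σᶠ_{L(t)/O₆^×} e⁻¹`
(`finsum_unit_classes_four_mul_eq`, the descent `L(4t) = 2·L(t)` at the ramified prime `2`) and `Σ_{c ∣ 2n, (c,6)=1} =
Σ_{c ∣ n, (c,6)=1}` (KRY's restriction `(c, D) = 1`). This file draws the consequences: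

* §1 SIX NEW ROWS OF THE TABLE, `t = 4, 9, 12, 24, 36, 100` (`= 4·1, 9·1, 4·3, 4·6, 4·9·1, 4·25`): the identity
  (3.4.14) = (3.4.4)·(3.4.6) holds for them — each a three-line reduction to the row `t/4` resp. `t/9` (the two index sets
  `{c ∣ n : (c,6) = 1}` and `{c ∣ n' : (c,6) = 1}` coincide by kernel decision). The earlier `deg_Z_four_nine_bookkeeping`,
  `deg_Z_twelve_twentyfour_bookkeeping` of `…XSixSpecialCyclesScaling` were arithmetic on recorded numbers only.
* §2 THE EIGHTEEN VALUES `deg Z(t)_ℚ = 2·Σᶠ_{L(t)/O₆^×} e⁻¹ = 1, 0, 2/3, 1, 2, 0, 1, 4, 2/3, 4, 4, 4, 4, 2, 5, 1, 14/3, 5` for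
  `t = 1, 2, 3, 4, 6, 7, 9, 10, 12, 13, 19, 21, 22, 24, 25, 36, 75, 100` — the right sides evaluated once and for all
  (`BinQF.classNumber` by kernel decision, `χ₈` by `decide`, `(−d∕3)` by `norm_num`), so that later files can quote
  `deg Z(t)_ℚ` as a number.

| `t`   | `4t = n²d`    | `{c ∣ n : (c,6)=1}` | `δ(d,6)` | `Σ h(−c²d)/w(−c²d)` | `deg Z(t)_ℚ` |
|-------|---------------|---------------------|----------|---------------------|--------------|
| `1`   | `1²·4`        | `{1}`               | `2`      | `1/4`               | `1`          |
| `2`   | `1²·8`        | `{1}`               | `0`      | `1/2`               | `0`          |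
| `3`   | `2²·3`        | `{1}`               | `2`      | `1/6`               | `2/3`        |
| `4`   | `2²·4`        | `{1}`               | `2`      | `1/4`               | `1`          |
| `6`   | `1²·24`       | `{1}`               | `1`      | `2/2`               | `2`          |
| `7`   | `2²·7`        | `{1}`               | `0`      | `1/2`               | `0`          |
| `9`   | `3²·4`        | `{1}`               | `2`      | `1/4`               | `1`          |
| `10`  | `1²·40`       | `{1}`               | `2`      | `2/2`               | `4`          |
| `12`  | `4²·3`        | `{1}`               | `2`      | `1/6`               | `2/3`        |
| `13`  | `1²·52`       | `{1}`               | `2`      | `2/2`               | `4`          |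
| `19`  | `2²·19`       | `{1}`               | `4`      | `1/2`               | `4`          |
| `21`  | `1²·84`       | `{1}`               | `1`      | `4/2`               | `4`          |
| `22`  | `1²·88`       | `{1}`               | `2`      | `2/2`               | `4`          |
| `24`  | `2²·24`       | `{1}`               | `1`      | `2/2`               | `2`          |
| `25`  | `5²·4`        | `{1, 5}`            | `2`      | `1/4 + 2/2`         | `5`          |
| `36`  | `6²·4`        | `{1}`               | `2`      | `1/4`               | `1`          |
| `75`  | `10²·3`       | `{1, 5}`            | `2`      | `1/6 + 2/2`         | `14/3`       |
| `100` | `10²·4`       | `{1, 5}`            | `2`      | `1/4 + 2/2`         | `5`          |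

## Sources

* [KRY] S. Kudla, M. Rapoport, T. Yang, *Modular Forms and Special Cycles on Shimura Curves*, Ann. of Math. Stud. 161
  (2006), §3.4 (3.4.4)–(3.4.6) («`deg Z(t)_ℚ = 2δ(d;D(B))H₀(t;D(B))`», «`H₀(t;D) = Σ_{c∣n} h(c²d)/w(c²d)` …
  `(c, D) = 1`»), (3.4.13)–(3.4.14) («`deg Z(t)_ℚ = 2 Σ_{x ∈ L(t) mod Γ} e_x⁻¹`»). [cite: KudlaRapoportYang2006, §3.4 (3.4.4)–(3.4.6), (3.4.13)–(3.4.14)]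
* [Vignéras] M.-F. Vignéras, *Arithmétique des algèbres de quaternions*, LNM 800 (1980), Ch. II §3 and Ch. III §5.C
  Cor. 5.12–5.14 (no optimal embedding of a non-maximal order at a ramified prime; the embedding numbers).
  [cite: VignerasLNM800, Ch. II §3; Ch. III §5.C Cor. 5.12–5.14]
* [Cox] D. A. Cox, *Primes of the form x² + ny²*, 2nd ed. (2013), §2.A Thm. 2.13, §7.A Lemma 7.2, §7.B Thm. 7.7 (the class
  numbers `h(−4) = h(−3) = h(−8) = h(−7) = h(−19) = 1`, `h(−24) = h(−40) = h(−52) = h(−88) = h(−75) = h(−100) = 2`,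
  `h(−84) = 4`). [cite: Cox2013, §2.A Thm. 2.13, §7.A Lemma 7.2, §7.B Thm. 7.7]

## Scope (honest)

Theorems only — no definitions, no named facts, no instances; the sums are the inline expressions of
`…XSixSpecialCyclesDegree`. The identity (3.4.14) = (3.4.4)·(3.4.6) is established here for eighteen values of `t` (and, by
`finsum_unit_classes_pow_mul_eq` ∕ `degree_rhs_two_mul_eq` ∕ `degree_rhs_three_mul_eq` of `…DegreeStructure`, is
transported along `t ↦ 4^a9^bt`), NOT for general `t`.
-/

set_option maxSynthPendingDepth 3

open Quaternion Literature.NumberTheory.QuadraticFields.Quadratic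

namespace Literature.Geometry.Kaehler.ComplexTorus.QuaternionType

/-! ## §0 Helper -/

section Helper

/-- Transport of the degree sum along an equality of norms. [folklore] -/
private theorem degreeSum_congr₄₀ {t₁ t₂ : ℤ} (h : t₁ = t₂) :
    ∑ᶠ q : (Quot (fun x y : {x : ℤ × ℤ × ℤ // x.1 ^ 2 - 3 * x.2.1 ^ 2 - 3 * x.2.2 ^ 2 = t₁} ↦
      ∃ v : ℍ[ℚ,((-1 : ℤ) : ℚ),((3 : ℤ) : ℚ)], (v ∈ order (-1) 3 ∨ v - ⟨1/2, 1/2, 1/2, -1/2⟩ ∈ order (-1) 3) ∧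
        ((v * star v).re = 1 ∨ (v * star v).re = -1) ∧
        v * ⟨0, x.1.1, x.1.2.1, x.1.2.2⟩ = ⟨0, y.1.1, y.1.2.1, y.1.2.2⟩ * v)),
        ((Nat.card
          {u : ℍ[ℚ,((-1 : ℤ) : ℚ),((3 : ℤ) : ℚ)] // (u ∈ order (-1) 3 ∨ u - ⟨1/2, 1/2, 1/2, -1/2⟩ ∈ order (-1) 3) ∧
            ((u * star u).re = 1 ∨ (u * star u).re = -1) ∧
            u * ⟨0, q.out.1.1, q.out.1.2.1, q.out.1.2.2⟩ = ⟨0, q.out.1.1, q.out.1.2.1, q.out.1.2.2⟩ * u} : ℚ))⁻¹ =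
    ∑ᶠ q : (Quot (fun x y : {x : ℤ × ℤ × ℤ // x.1 ^ 2 - 3 * x.2.1 ^ 2 - 3 * x.2.2 ^ 2 = t₂} ↦
      ∃ v : ℍ[ℚ,((-1 : ℤ) : ℚ),((3 : ℤ) : ℚ)], (v ∈ order (-1) 3 ∨ v - ⟨1/2, 1/2, 1/2, -1/2⟩ ∈ order (-1) 3) ∧
        ((v * star v).re = 1 ∨ (v * star v).re = -1) ∧
        v * ⟨0, x.1.1, x.1.2.1, x.1.2.2⟩ = ⟨0, y.1.1, y.1.2.1, y.1.2.2⟩ * v)),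
        ((Nat.card
          {u : ℍ[ℚ,((-1 : ℤ) : ℚ),((3 : ℤ) : ℚ)] // (u ∈ order (-1) 3 ∨ u - ⟨1/2, 1/2, 1/2, -1/2⟩ ∈ order (-1) 3) ∧
            ((u * star u).re = 1 ∨ (u * star u).re = -1) ∧
            u * ⟨0, q.out.1.1, q.out.1.2.1, q.out.1.2.2⟩ = ⟨0, q.out.1.1, q.out.1.2.1, q.out.1.2.2⟩ * u} : ℚ))⁻¹ := by
  subst h
  rfl

end Helper

/-! ## §1 Six new rows: `t = 4, 9, 12, 24, 36, 100` -/

section Rows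

/-- **`deg Z(4)_ℚ`: (3.4.14) = (3.4.4)·(3.4.6) at `t = 4`** — `L(4) = 2·L(1)`: two `O₆^×`-classes `[±2i]` with `e = 4` (`ℚ(2i) ∩ O₆ = ℤ[i]`), `2·(2·¼) = 1`; right side `4·4 = 2²·4`, `c ∣ 2` with `(c,6) = 1` is `c = 1` only: `2·2·h(−4)/4 = 1` — the row `t = 1` on both sides. [cite: KudlaRapoportYang2006, §3.4 (3.4.4)–(3.4.6) and (3.4.14)] [cite: VignerasLNM800, Ch. II §3] -/
theorem degree_formula_four :
    2 * ∑ᶠ q : (Quot (fun x y : {x : ℤ × ℤ × ℤ // x.1 ^ 2 - 3 * x.2.1 ^ 2 - 3 * x.2.2 ^ 2 = 4} ↦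
      ∃ v : ℍ[ℚ,((-1 : ℤ) : ℚ),((3 : ℤ) : ℚ)], (v ∈ order (-1) 3 ∨ v - ⟨1/2, 1/2, 1/2, -1/2⟩ ∈ order (-1) 3) ∧
        ((v * star v).re = 1 ∨ (v * star v).re = -1) ∧
        v * ⟨0, x.1.1, x.1.2.1, x.1.2.2⟩ = ⟨0, y.1.1, y.1.2.1, y.1.2.2⟩ * v)),
        ((Nat.card
          {u : ℍ[ℚ,((-1 : ℤ) : ℚ),((3 : ℤ) : ℚ)] // (u ∈ order (-1) 3 ∨ u - ⟨1/2, 1/2, 1/2, -1/2⟩ ∈ order (-1) 3) ∧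
            ((u * star u).re = 1 ∨ (u * star u).re = -1) ∧
            u * ⟨0, q.out.1.1, q.out.1.2.1, q.out.1.2.2⟩ = ⟨0, q.out.1.1, q.out.1.2.1, q.out.1.2.2⟩ * u} : ℚ))⁻¹ =
      2 * ((((1 - ZMod.χ₈ ((-4 : ℤ) : ZMod 8)) * (1 - legendreSym 3 (-4)) : ℤ)) : ℚ) *
        ∑ c ∈ Nat.divisors 2 with Nat.Coprime c 6,
          (BinQF.classNumber (-((c : ℤ) ^ 2 * 4)) : ℚ) /
            (if (c : ℤ) ^ 2 * 4 = 3 then 6 else if (c : ℤ) ^ 2 * 4 = 4 then 4 else 2) := by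
  rw [degreeSum_congr₄₀ (show (4 : ℤ) = 4 * 1 by norm_num), finsum_unit_classes_four_mul_eq, degree_formula_one]
  rw [show (Nat.divisors 1).filter (fun c ↦ Nat.Coprime c 6) = {1} from by decide,
    show (Nat.divisors 2).filter (fun c ↦ Nat.Coprime c 6) = {1} from by decide]

/-- **`deg Z(9)_ℚ`: (3.4.14) = (3.4.4)·(3.4.6) at `t = 9`** — `L(9) = 3·L(1)`: two classes `[±3i]` with `e = 4`, `2·(2·¼) = 1`; right side `4·9 = 3²·4`, `c ∣ 3`, `(c,6) = 1` ⟹ `c = 1`: `2·2·h(−4)/4 = 1`. [cite: KudlaRapoportYang2006, §3.4 (3.4.4)–(3.4.6) and (3.4.14)] [cite: VignerasLNM800, Ch. II §3] -/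
theorem degree_formula_nine :
    2 * ∑ᶠ q : (Quot (fun x y : {x : ℤ × ℤ × ℤ // x.1 ^ 2 - 3 * x.2.1 ^ 2 - 3 * x.2.2 ^ 2 = 9} ↦
      ∃ v : ℍ[ℚ,((-1 : ℤ) : ℚ),((3 : ℤ) : ℚ)], (v ∈ order (-1) 3 ∨ v - ⟨1/2, 1/2, 1/2, -1/2⟩ ∈ order (-1) 3) ∧
        ((v * star v).re = 1 ∨ (v * star v).re = -1) ∧
        v * ⟨0, x.1.1, x.1.2.1, x.1.2.2⟩ = ⟨0, y.1.1, y.1.2.1, y.1.2.2⟩ * v)),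
        ((Nat.card
          {u : ℍ[ℚ,((-1 : ℤ) : ℚ),((3 : ℤ) : ℚ)] // (u ∈ order (-1) 3 ∨ u - ⟨1/2, 1/2, 1/2, -1/2⟩ ∈ order (-1) 3) ∧
            ((u * star u).re = 1 ∨ (u * star u).re = -1) ∧
            u * ⟨0, q.out.1.1, q.out.1.2.1, q.out.1.2.2⟩ = ⟨0, q.out.1.1, q.out.1.2.1, q.out.1.2.2⟩ * u} : ℚ))⁻¹ =
      2 * ((((1 - ZMod.χ₈ ((-4 : ℤ) : ZMod 8)) * (1 - legendreSym 3 (-4)) : ℤ)) : ℚ) *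
        ∑ c ∈ Nat.divisors 3 with Nat.Coprime c 6,
          (BinQF.classNumber (-((c : ℤ) ^ 2 * 4)) : ℚ) /
            (if (c : ℤ) ^ 2 * 4 = 3 then 6 else if (c : ℤ) ^ 2 * 4 = 4 then 4 else 2) := by
  rw [degreeSum_congr₄₀ (show (9 : ℤ) = 9 * 1 by norm_num), finsum_unit_classes_nine_mul_eq, degree_formula_one]
  rw [show (Nat.divisors 1).filter (fun c ↦ Nat.Coprime c 6) = {1} from by decide,
    show (Nat.divisors 3).filter (fun c ↦ Nat.Coprime c 6) = {1} from by decide]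

/-- **`deg Z(12)_ℚ`: (3.4.14) = (3.4.4)·(3.4.6) at `t = 12`** — `L(12) = 2·L(3)`: two classes with `e = 6` (`ℤ[ζ₃]^×`), `2·(2·⅙) = 2/3`; right side `4·12 = 4²·3`, `c ∣ 4`, `(c,6) = 1` ⟹ `c = 1`: `2·2·h(−3)/6 = 2/3` — the row `t = 3`. [cite: KudlaRapoportYang2006, §3.4 (3.4.4)–(3.4.6) and (3.4.14)] [cite: VignerasLNM800, Ch. II §3] -/
theorem degree_formula_twelve :
    2 * ∑ᶠ q : (Quot (fun x y : {x : ℤ × ℤ × ℤ // x.1 ^ 2 - 3 * x.2.1 ^ 2 - 3 * x.2.2 ^ 2 = 12} ↦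
      ∃ v : ℍ[ℚ,((-1 : ℤ) : ℚ),((3 : ℤ) : ℚ)], (v ∈ order (-1) 3 ∨ v - ⟨1/2, 1/2, 1/2, -1/2⟩ ∈ order (-1) 3) ∧
        ((v * star v).re = 1 ∨ (v * star v).re = -1) ∧
        v * ⟨0, x.1.1, x.1.2.1, x.1.2.2⟩ = ⟨0, y.1.1, y.1.2.1, y.1.2.2⟩ * v)),
        ((Nat.card
          {u : ℍ[ℚ,((-1 : ℤ) : ℚ),((3 : ℤ) : ℚ)] // (u ∈ order (-1) 3 ∨ u - ⟨1/2, 1/2, 1/2, -1/2⟩ ∈ order (-1) 3) ∧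
            ((u * star u).re = 1 ∨ (u * star u).re = -1) ∧
            u * ⟨0, q.out.1.1, q.out.1.2.1, q.out.1.2.2⟩ = ⟨0, q.out.1.1, q.out.1.2.1, q.out.1.2.2⟩ * u} : ℚ))⁻¹ =
      2 * ((((1 - ZMod.χ₈ ((-3 : ℤ) : ZMod 8)) * (1 - legendreSym 3 (-3)) : ℤ)) : ℚ) *
        ∑ c ∈ Nat.divisors 4 with Nat.Coprime c 6,
          (BinQF.classNumber (-((c : ℤ) ^ 2 * 3)) : ℚ) /
            (if (c : ℤ) ^ 2 * 3 = 3 then 6 else if (c : ℤ) ^ 2 * 3 = 4 then 4 else 2) := by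
  rw [degreeSum_congr₄₀ (show (12 : ℤ) = 4 * 3 by norm_num), finsum_unit_classes_four_mul_eq, degree_formula_three]
  rw [show (Nat.divisors 2).filter (fun c ↦ Nat.Coprime c 6) = {1} from by decide,
    show (Nat.divisors 4).filter (fun c ↦ Nat.Coprime c 6) = {1} from by decide]

/-- **`deg Z(24)_ℚ`: (3.4.14) = (3.4.4)·(3.4.6) at `t = 24`** — `L(24) = 2·L(6)`: two classes with `e = 2`, `2·(2·½) = 2`; right side `4·24 = 2²·24`, `c ∣ 2`, `(c,6) = 1` ⟹ `c = 1`: `2·1·h(−24)/2 = 2` — the row `t = 6`. [cite: KudlaRapoportYang2006, §3.4 (3.4.4)–(3.4.6) and (3.4.14)] [cite: VignerasLNM800, Ch. II §3] -/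
theorem degree_formula_twentyfour :
    2 * ∑ᶠ q : (Quot (fun x y : {x : ℤ × ℤ × ℤ // x.1 ^ 2 - 3 * x.2.1 ^ 2 - 3 * x.2.2 ^ 2 = 24} ↦
      ∃ v : ℍ[ℚ,((-1 : ℤ) : ℚ),((3 : ℤ) : ℚ)], (v ∈ order (-1) 3 ∨ v - ⟨1/2, 1/2, 1/2, -1/2⟩ ∈ order (-1) 3) ∧
        ((v * star v).re = 1 ∨ (v * star v).re = -1) ∧
        v * ⟨0, x.1.1, x.1.2.1, x.1.2.2⟩ = ⟨0, y.1.1, y.1.2.1, y.1.2.2⟩ * v)),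
        ((Nat.card
          {u : ℍ[ℚ,((-1 : ℤ) : ℚ),((3 : ℤ) : ℚ)] // (u ∈ order (-1) 3 ∨ u - ⟨1/2, 1/2, 1/2, -1/2⟩ ∈ order (-1) 3) ∧
            ((u * star u).re = 1 ∨ (u * star u).re = -1) ∧
            u * ⟨0, q.out.1.1, q.out.1.2.1, q.out.1.2.2⟩ = ⟨0, q.out.1.1, q.out.1.2.1, q.out.1.2.2⟩ * u} : ℚ))⁻¹ =
      2 * ((((1 - ZMod.χ₈ ((-24 : ℤ) : ZMod 8)) * (1 - legendreSym 3 (-24)) : ℤ)) : ℚ) *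
        ∑ c ∈ Nat.divisors 2 with Nat.Coprime c 6,
          (BinQF.classNumber (-((c : ℤ) ^ 2 * 24)) : ℚ) /
            (if (c : ℤ) ^ 2 * 24 = 3 then 6 else if (c : ℤ) ^ 2 * 24 = 4 then 4 else 2) := by
  rw [degreeSum_congr₄₀ (show (24 : ℤ) = 4 * 6 by norm_num), finsum_unit_classes_four_mul_eq, degree_formula_six]
  rw [show (Nat.divisors 1).filter (fun c ↦ Nat.Coprime c 6) = {1} from by decide,
    show (Nat.divisors 2).filter (fun c ↦ Nat.Coprime c 6) = {1} from by decide]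

/-- **`deg Z(36)_ℚ`: (3.4.14) = (3.4.4)·(3.4.6) at `t = 36`** — `L(36) = 6·L(1)`: two classes `[±6i]` with `e = 4`, `2·(2·¼) = 1`; right side `4·36 = 6²·4`, `c ∣ 6`, `(c,6) = 1` ⟹ `c = 1`: `2·2·h(−4)/4 = 1` — the row `t = 1` through `t = 9`. [cite: KudlaRapoportYang2006, §3.4 (3.4.4)–(3.4.6) and (3.4.14)] [cite: VignerasLNM800, Ch. II §3] -/
theorem degree_formula_thirtysix :
    2 * ∑ᶠ q : (Quot (fun x y : {x : ℤ × ℤ × ℤ // x.1 ^ 2 - 3 * x.2.1 ^ 2 - 3 * x.2.2 ^ 2 = 36} ↦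
      ∃ v : ℍ[ℚ,((-1 : ℤ) : ℚ),((3 : ℤ) : ℚ)], (v ∈ order (-1) 3 ∨ v - ⟨1/2, 1/2, 1/2, -1/2⟩ ∈ order (-1) 3) ∧
        ((v * star v).re = 1 ∨ (v * star v).re = -1) ∧
        v * ⟨0, x.1.1, x.1.2.1, x.1.2.2⟩ = ⟨0, y.1.1, y.1.2.1, y.1.2.2⟩ * v)),
        ((Nat.card
          {u : ℍ[ℚ,((-1 : ℤ) : ℚ),((3 : ℤ) : ℚ)] // (u ∈ order (-1) 3 ∨ u - ⟨1/2, 1/2, 1/2, -1/2⟩ ∈ order (-1) 3) ∧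
            ((u * star u).re = 1 ∨ (u * star u).re = -1) ∧
            u * ⟨0, q.out.1.1, q.out.1.2.1, q.out.1.2.2⟩ = ⟨0, q.out.1.1, q.out.1.2.1, q.out.1.2.2⟩ * u} : ℚ))⁻¹ =
      2 * ((((1 - ZMod.χ₈ ((-4 : ℤ) : ZMod 8)) * (1 - legendreSym 3 (-4)) : ℤ)) : ℚ) *
        ∑ c ∈ Nat.divisors 6 with Nat.Coprime c 6,
          (BinQF.classNumber (-((c : ℤ) ^ 2 * 4)) : ℚ) /
            (if (c : ℤ) ^ 2 * 4 = 3 then 6 else if (c : ℤ) ^ 2 * 4 = 4 then 4 else 2) := by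
  rw [degreeSum_congr₄₀ (show (36 : ℤ) = 4 * (9 * 1) by norm_num), finsum_unit_classes_four_mul_eq,
    finsum_unit_classes_nine_mul_eq, degree_formula_one]
  rw [show (Nat.divisors 1).filter (fun c ↦ Nat.Coprime c 6) = {1} from by decide,
    show (Nat.divisors 6).filter (fun c ↦ Nat.Coprime c 6) = {1} from by decide]

/-- **`deg Z(100)_ℚ`: (3.4.14) = (3.4.4)·(3.4.6) at `t = 100`** — `L(100) = 2·L(25)`: six classes, four with `e = 2` (primitive part of norm `25`) and two with `e = 4` (`[±10i]`), `2·(4·½ + 2·¼) = 5`; right side `4·100 = 10²·4`, `{c ∣ 10 : (c,6) = 1} = {1, 5} = {c ∣ 5 : (c,6) = 1}`: `2·2·(h(−4)/4 + h(−100)/2) = 5` — the row `t = 25`. [cite: KudlaRapoportYang2006, §3.4 (3.4.4)–(3.4.6) and (3.4.14)] [cite: VignerasLNM800, Ch. II §3] -/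
theorem degree_formula_hundred :
    2 * ∑ᶠ q : (Quot (fun x y : {x : ℤ × ℤ × ℤ // x.1 ^ 2 - 3 * x.2.1 ^ 2 - 3 * x.2.2 ^ 2 = 100} ↦
      ∃ v : ℍ[ℚ,((-1 : ℤ) : ℚ),((3 : ℤ) : ℚ)], (v ∈ order (-1) 3 ∨ v - ⟨1/2, 1/2, 1/2, -1/2⟩ ∈ order (-1) 3) ∧
        ((v * star v).re = 1 ∨ (v * star v).re = -1) ∧
        v * ⟨0, x.1.1, x.1.2.1, x.1.2.2⟩ = ⟨0, y.1.1, y.1.2.1, y.1.2.2⟩ * v)),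
        ((Nat.card
          {u : ℍ[ℚ,((-1 : ℤ) : ℚ),((3 : ℤ) : ℚ)] // (u ∈ order (-1) 3 ∨ u - ⟨1/2, 1/2, 1/2, -1/2⟩ ∈ order (-1) 3) ∧
            ((u * star u).re = 1 ∨ (u * star u).re = -1) ∧
            u * ⟨0, q.out.1.1, q.out.1.2.1, q.out.1.2.2⟩ = ⟨0, q.out.1.1, q.out.1.2.1, q.out.1.2.2⟩ * u} : ℚ))⁻¹ =
      2 * ((((1 - ZMod.χ₈ ((-4 : ℤ) : ZMod 8)) * (1 - legendreSym 3 (-4)) : ℤ)) : ℚ) *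
        ∑ c ∈ Nat.divisors 10 with Nat.Coprime c 6,
          (BinQF.classNumber (-((c : ℤ) ^ 2 * 4)) : ℚ) /
            (if (c : ℤ) ^ 2 * 4 = 3 then 6 else if (c : ℤ) ^ 2 * 4 = 4 then 4 else 2) := by
  rw [degreeSum_congr₄₀ (show (100 : ℤ) = 4 * 25 by norm_num), finsum_unit_classes_four_mul_eq, degree_formula_twentyfive]
  rw [show (Nat.divisors 5).filter (fun c ↦ Nat.Coprime c 6) = {1, 5} from by decide,
    show (Nat.divisors 10).filter (fun c ↦ Nat.Coprime c 6) = {1, 5} from by decide]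

end Rows

/-! ## §2 The eighteen values of `deg Z(t)_ℚ` -/

section Values

/-- **`deg Z(1)_ℚ = 2·Σᶠ_{[x] ∈ L(1)/O₆^×} e_x⁻¹ = 1`** (`4·1 = 1²·4`; the right side of `degree_formula_one` evaluated: `h` by kernel decision, `χ₈(−4) = 0`, `(−4∕3) = -1`). [cite: KudlaRapoportYang2006, §3.4 (3.4.4)–(3.4.6) and (3.4.14)] [cite: Cox2013, §7.B Thm. 7.7] -/
theorem degree_value_one :
    2 * ∑ᶠ q : (Quot (fun x y : {x : ℤ × ℤ × ℤ // x.1 ^ 2 - 3 * x.2.1 ^ 2 - 3 * x.2.2 ^ 2 = 1} ↦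
      ∃ v : ℍ[ℚ,((-1 : ℤ) : ℚ),((3 : ℤ) : ℚ)], (v ∈ order (-1) 3 ∨ v - ⟨1/2, 1/2, 1/2, -1/2⟩ ∈ order (-1) 3) ∧
        ((v * star v).re = 1 ∨ (v * star v).re = -1) ∧
        v * ⟨0, x.1.1, x.1.2.1, x.1.2.2⟩ = ⟨0, y.1.1, y.1.2.1, y.1.2.2⟩ * v)),
        ((Nat.card
          {u : ℍ[ℚ,((-1 : ℤ) : ℚ),((3 : ℤ) : ℚ)] // (u ∈ order (-1) 3 ∨ u - ⟨1/2, 1/2, 1/2, -1/2⟩ ∈ order (-1) 3) ∧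
            ((u * star u).re = 1 ∨ (u * star u).re = -1) ∧
            u * ⟨0, q.out.1.1, q.out.1.2.1, q.out.1.2.2⟩ = ⟨0, q.out.1.1, q.out.1.2.1, q.out.1.2.2⟩ * u} : ℚ))⁻¹ = 1 := by
  rw [degree_formula_one,
    show (Nat.divisors 1).filter (fun c ↦ Nat.Coprime c 6) = {1} from by decide, Finset.sum_singleton]
  have hh : BinQF.classNumber (-(((1 : ℕ) : ℤ) ^ 2 * 4)) = 1 := by decide +kernel
  have h8 : ZMod.χ₈ ((-4 : ℤ) : ZMod 8) = 0 := by decide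
  have h3 : legendreSym 3 (-4) = -1 := by norm_num
  rw [hh, h8, h3]
  norm_num

/-- **`deg Z(2)_ℚ = 2·Σᶠ_{[x] ∈ L(2)/O₆^×} e_x⁻¹ = 0`** (`4·2 = 1²·8`; the right side of `degree_formula_two` evaluated: `h` by kernel decision, `χ₈(−8) = 0`, `(−8∕3) = 1`). [cite: KudlaRapoportYang2006, §3.4 (3.4.4)–(3.4.6) and (3.4.14)] [cite: Cox2013, §7.B Thm. 7.7] -/
theorem degree_value_two :
    2 * ∑ᶠ q : (Quot (fun x y : {x : ℤ × ℤ × ℤ // x.1 ^ 2 - 3 * x.2.1 ^ 2 - 3 * x.2.2 ^ 2 = 2} ↦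
      ∃ v : ℍ[ℚ,((-1 : ℤ) : ℚ),((3 : ℤ) : ℚ)], (v ∈ order (-1) 3 ∨ v - ⟨1/2, 1/2, 1/2, -1/2⟩ ∈ order (-1) 3) ∧
        ((v * star v).re = 1 ∨ (v * star v).re = -1) ∧
        v * ⟨0, x.1.1, x.1.2.1, x.1.2.2⟩ = ⟨0, y.1.1, y.1.2.1, y.1.2.2⟩ * v)),
        ((Nat.card
          {u : ℍ[ℚ,((-1 : ℤ) : ℚ),((3 : ℤ) : ℚ)] // (u ∈ order (-1) 3 ∨ u - ⟨1/2, 1/2, 1/2, -1/2⟩ ∈ order (-1) 3) ∧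
            ((u * star u).re = 1 ∨ (u * star u).re = -1) ∧
            u * ⟨0, q.out.1.1, q.out.1.2.1, q.out.1.2.2⟩ = ⟨0, q.out.1.1, q.out.1.2.1, q.out.1.2.2⟩ * u} : ℚ))⁻¹ = 0 := by
  rw [degree_formula_two,
    show (Nat.divisors 1).filter (fun c ↦ Nat.Coprime c 6) = {1} from by decide, Finset.sum_singleton]
  have hh : BinQF.classNumber (-(((1 : ℕ) : ℤ) ^ 2 * 8)) = 1 := by decide +kernel
  have h8 : ZMod.χ₈ ((-8 : ℤ) : ZMod 8) = 0 := by decide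
  have h3 : legendreSym 3 (-8) = 1 := by norm_num
  rw [hh, h8, h3]
  norm_num

/-- **`deg Z(3)_ℚ = 2·Σᶠ_{[x] ∈ L(3)/O₆^×} e_x⁻¹ = 2/3`** (`4·3 = 2²·3`; the right side of `degree_formula_three` evaluated: `h` by kernel decision, `χ₈(−3) = -1`, `(−3∕3) = 0`). [cite: KudlaRapoportYang2006, §3.4 (3.4.4)–(3.4.6) and (3.4.14)] [cite: Cox2013, §7.B Thm. 7.7] -/
theorem degree_value_three :
    2 * ∑ᶠ q : (Quot (fun x y : {x : ℤ × ℤ × ℤ // x.1 ^ 2 - 3 * x.2.1 ^ 2 - 3 * x.2.2 ^ 2 = 3} ↦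
      ∃ v : ℍ[ℚ,((-1 : ℤ) : ℚ),((3 : ℤ) : ℚ)], (v ∈ order (-1) 3 ∨ v - ⟨1/2, 1/2, 1/2, -1/2⟩ ∈ order (-1) 3) ∧
        ((v * star v).re = 1 ∨ (v * star v).re = -1) ∧
        v * ⟨0, x.1.1, x.1.2.1, x.1.2.2⟩ = ⟨0, y.1.1, y.1.2.1, y.1.2.2⟩ * v)),
        ((Nat.card
          {u : ℍ[ℚ,((-1 : ℤ) : ℚ),((3 : ℤ) : ℚ)] // (u ∈ order (-1) 3 ∨ u - ⟨1/2, 1/2, 1/2, -1/2⟩ ∈ order (-1) 3) ∧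
            ((u * star u).re = 1 ∨ (u * star u).re = -1) ∧
            u * ⟨0, q.out.1.1, q.out.1.2.1, q.out.1.2.2⟩ = ⟨0, q.out.1.1, q.out.1.2.1, q.out.1.2.2⟩ * u} : ℚ))⁻¹ = 2 / 3 := by
  rw [degree_formula_three,
    show (Nat.divisors 2).filter (fun c ↦ Nat.Coprime c 6) = {1} from by decide, Finset.sum_singleton]
  have hh : BinQF.classNumber (-(((1 : ℕ) : ℤ) ^ 2 * 3)) = 1 := by decide +kernel
  have h8 : ZMod.χ₈ ((-3 : ℤ) : ZMod 8) = -1 := by decide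
  have h3 : legendreSym 3 (-3) = 0 := by norm_num
  rw [hh, h8, h3]
  norm_num

/-- **`deg Z(4)_ℚ = 2·Σᶠ_{[x] ∈ L(4)/O₆^×} e_x⁻¹ = 1`** (`4·4 = 2²·4`; the right side of `degree_formula_four` evaluated: `h` by kernel decision, `χ₈(−4) = 0`, `(−4∕3) = -1`). [cite: KudlaRapoportYang2006, §3.4 (3.4.4)–(3.4.6) and (3.4.14)] [cite: Cox2013, §7.B Thm. 7.7] -/
theorem degree_value_four :
    2 * ∑ᶠ q : (Quot (fun x y : {x : ℤ × ℤ × ℤ // x.1 ^ 2 - 3 * x.2.1 ^ 2 - 3 * x.2.2 ^ 2 = 4} ↦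
      ∃ v : ℍ[ℚ,((-1 : ℤ) : ℚ),((3 : ℤ) : ℚ)], (v ∈ order (-1) 3 ∨ v - ⟨1/2, 1/2, 1/2, -1/2⟩ ∈ order (-1) 3) ∧
        ((v * star v).re = 1 ∨ (v * star v).re = -1) ∧
        v * ⟨0, x.1.1, x.1.2.1, x.1.2.2⟩ = ⟨0, y.1.1, y.1.2.1, y.1.2.2⟩ * v)),
        ((Nat.card
          {u : ℍ[ℚ,((-1 : ℤ) : ℚ),((3 : ℤ) : ℚ)] // (u ∈ order (-1) 3 ∨ u - ⟨1/2, 1/2, 1/2, -1/2⟩ ∈ order (-1) 3) ∧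
            ((u * star u).re = 1 ∨ (u * star u).re = -1) ∧
            u * ⟨0, q.out.1.1, q.out.1.2.1, q.out.1.2.2⟩ = ⟨0, q.out.1.1, q.out.1.2.1, q.out.1.2.2⟩ * u} : ℚ))⁻¹ = 1 := by
  rw [degree_formula_four,
    show (Nat.divisors 2).filter (fun c ↦ Nat.Coprime c 6) = {1} from by decide, Finset.sum_singleton]
  have hh : BinQF.classNumber (-(((1 : ℕ) : ℤ) ^ 2 * 4)) = 1 := by decide +kernel
  have h8 : ZMod.χ₈ ((-4 : ℤ) : ZMod 8) = 0 := by decide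
  have h3 : legendreSym 3 (-4) = -1 := by norm_num
  rw [hh, h8, h3]
  norm_num

/-- **`deg Z(6)_ℚ = 2·Σᶠ_{[x] ∈ L(6)/O₆^×} e_x⁻¹ = 2`** (`4·6 = 1²·24`; the right side of `degree_formula_six` evaluated: `h` by kernel decision, `χ₈(−24) = 0`, `(−24∕3) = 0`). [cite: KudlaRapoportYang2006, §3.4 (3.4.4)–(3.4.6) and (3.4.14)] [cite: Cox2013, §7.B Thm. 7.7] -/
theorem degree_value_six :
    2 * ∑ᶠ q : (Quot (fun x y : {x : ℤ × ℤ × ℤ // x.1 ^ 2 - 3 * x.2.1 ^ 2 - 3 * x.2.2 ^ 2 = 6} ↦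
      ∃ v : ℍ[ℚ,((-1 : ℤ) : ℚ),((3 : ℤ) : ℚ)], (v ∈ order (-1) 3 ∨ v - ⟨1/2, 1/2, 1/2, -1/2⟩ ∈ order (-1) 3) ∧
        ((v * star v).re = 1 ∨ (v * star v).re = -1) ∧
        v * ⟨0, x.1.1, x.1.2.1, x.1.2.2⟩ = ⟨0, y.1.1, y.1.2.1, y.1.2.2⟩ * v)),
        ((Nat.card
          {u : ℍ[ℚ,((-1 : ℤ) : ℚ),((3 : ℤ) : ℚ)] // (u ∈ order (-1) 3 ∨ u - ⟨1/2, 1/2, 1/2, -1/2⟩ ∈ order (-1) 3) ∧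
            ((u * star u).re = 1 ∨ (u * star u).re = -1) ∧
            u * ⟨0, q.out.1.1, q.out.1.2.1, q.out.1.2.2⟩ = ⟨0, q.out.1.1, q.out.1.2.1, q.out.1.2.2⟩ * u} : ℚ))⁻¹ = 2 := by
  rw [degree_formula_six,
    show (Nat.divisors 1).filter (fun c ↦ Nat.Coprime c 6) = {1} from by decide, Finset.sum_singleton]
  have hh : BinQF.classNumber (-(((1 : ℕ) : ℤ) ^ 2 * 24)) = 2 := by decide +kernel
  have h8 : ZMod.χ₈ ((-24 : ℤ) : ZMod 8) = 0 := by decide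
  have h3 : legendreSym 3 (-24) = 0 := by norm_num
  rw [hh, h8, h3]
  norm_num

/-- **`deg Z(7)_ℚ = 2·Σᶠ_{[x] ∈ L(7)/O₆^×} e_x⁻¹ = 0`** (`4·7 = 2²·7`; the right side of `degree_formula_seven` evaluated: `h` by kernel decision, `χ₈(−7) = 1`, `(−7∕3) = -1`). [cite: KudlaRapoportYang2006, §3.4 (3.4.4)–(3.4.6) and (3.4.14)] [cite: Cox2013, §7.B Thm. 7.7] -/
theorem degree_value_seven :
    2 * ∑ᶠ q : (Quot (fun x y : {x : ℤ × ℤ × ℤ // x.1 ^ 2 - 3 * x.2.1 ^ 2 - 3 * x.2.2 ^ 2 = 7} ↦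
      ∃ v : ℍ[ℚ,((-1 : ℤ) : ℚ),((3 : ℤ) : ℚ)], (v ∈ order (-1) 3 ∨ v - ⟨1/2, 1/2, 1/2, -1/2⟩ ∈ order (-1) 3) ∧
        ((v * star v).re = 1 ∨ (v * star v).re = -1) ∧
        v * ⟨0, x.1.1, x.1.2.1, x.1.2.2⟩ = ⟨0, y.1.1, y.1.2.1, y.1.2.2⟩ * v)),
        ((Nat.card
          {u : ℍ[ℚ,((-1 : ℤ) : ℚ),((3 : ℤ) : ℚ)] // (u ∈ order (-1) 3 ∨ u - ⟨1/2, 1/2, 1/2, -1/2⟩ ∈ order (-1) 3) ∧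
            ((u * star u).re = 1 ∨ (u * star u).re = -1) ∧
            u * ⟨0, q.out.1.1, q.out.1.2.1, q.out.1.2.2⟩ = ⟨0, q.out.1.1, q.out.1.2.1, q.out.1.2.2⟩ * u} : ℚ))⁻¹ = 0 := by
  rw [degree_formula_seven,
    show (Nat.divisors 2).filter (fun c ↦ Nat.Coprime c 6) = {1} from by decide, Finset.sum_singleton]
  have hh : BinQF.classNumber (-(((1 : ℕ) : ℤ) ^ 2 * 7)) = 1 := by decide +kernel
  have h8 : ZMod.χ₈ ((-7 : ℤ) : ZMod 8) = 1 := by decide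
  have h3 : legendreSym 3 (-7) = -1 := by norm_num
  rw [hh, h8, h3]
  norm_num

/-- **`deg Z(9)_ℚ = 2·Σᶠ_{[x] ∈ L(9)/O₆^×} e_x⁻¹ = 1`** (`4·9 = 3²·4`; the right side of `degree_formula_nine` evaluated: `h` by kernel decision, `χ₈(−4) = 0`, `(−4∕3) = -1`). [cite: KudlaRapoportYang2006, §3.4 (3.4.4)–(3.4.6) and (3.4.14)] [cite: Cox2013, §7.B Thm. 7.7] -/
theorem degree_value_nine :
    2 * ∑ᶠ q : (Quot (fun x y : {x : ℤ × ℤ × ℤ // x.1 ^ 2 - 3 * x.2.1 ^ 2 - 3 * x.2.2 ^ 2 = 9} ↦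
      ∃ v : ℍ[ℚ,((-1 : ℤ) : ℚ),((3 : ℤ) : ℚ)], (v ∈ order (-1) 3 ∨ v - ⟨1/2, 1/2, 1/2, -1/2⟩ ∈ order (-1) 3) ∧
        ((v * star v).re = 1 ∨ (v * star v).re = -1) ∧
        v * ⟨0, x.1.1, x.1.2.1, x.1.2.2⟩ = ⟨0, y.1.1, y.1.2.1, y.1.2.2⟩ * v)),
        ((Nat.card
          {u : ℍ[ℚ,((-1 : ℤ) : ℚ),((3 : ℤ) : ℚ)] // (u ∈ order (-1) 3 ∨ u - ⟨1/2, 1/2, 1/2, -1/2⟩ ∈ order (-1) 3) ∧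
            ((u * star u).re = 1 ∨ (u * star u).re = -1) ∧
            u * ⟨0, q.out.1.1, q.out.1.2.1, q.out.1.2.2⟩ = ⟨0, q.out.1.1, q.out.1.2.1, q.out.1.2.2⟩ * u} : ℚ))⁻¹ = 1 := by
  rw [degree_formula_nine,
    show (Nat.divisors 3).filter (fun c ↦ Nat.Coprime c 6) = {1} from by decide, Finset.sum_singleton]
  have hh : BinQF.classNumber (-(((1 : ℕ) : ℤ) ^ 2 * 4)) = 1 := by decide +kernel
  have h8 : ZMod.χ₈ ((-4 : ℤ) : ZMod 8) = 0 := by decide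
  have h3 : legendreSym 3 (-4) = -1 := by norm_num
  rw [hh, h8, h3]
  norm_num

/-- **`deg Z(10)_ℚ = 2·Σᶠ_{[x] ∈ L(10)/O₆^×} e_x⁻¹ = 4`** (`4·10 = 1²·40`; the right side of `degree_formula_ten` evaluated: `h` by kernel decision, `χ₈(−40) = 0`, `(−40∕3) = -1`). [cite: KudlaRapoportYang2006, §3.4 (3.4.4)–(3.4.6) and (3.4.14)] [cite: Cox2013, §7.B Thm. 7.7] -/
theorem degree_value_ten :
    2 * ∑ᶠ q : (Quot (fun x y : {x : ℤ × ℤ × ℤ // x.1 ^ 2 - 3 * x.2.1 ^ 2 - 3 * x.2.2 ^ 2 = 10} ↦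
      ∃ v : ℍ[ℚ,((-1 : ℤ) : ℚ),((3 : ℤ) : ℚ)], (v ∈ order (-1) 3 ∨ v - ⟨1/2, 1/2, 1/2, -1/2⟩ ∈ order (-1) 3) ∧
        ((v * star v).re = 1 ∨ (v * star v).re = -1) ∧
        v * ⟨0, x.1.1, x.1.2.1, x.1.2.2⟩ = ⟨0, y.1.1, y.1.2.1, y.1.2.2⟩ * v)),
        ((Nat.card
          {u : ℍ[ℚ,((-1 : ℤ) : ℚ),((3 : ℤ) : ℚ)] // (u ∈ order (-1) 3 ∨ u - ⟨1/2, 1/2, 1/2, -1/2⟩ ∈ order (-1) 3) ∧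
            ((u * star u).re = 1 ∨ (u * star u).re = -1) ∧
            u * ⟨0, q.out.1.1, q.out.1.2.1, q.out.1.2.2⟩ = ⟨0, q.out.1.1, q.out.1.2.1, q.out.1.2.2⟩ * u} : ℚ))⁻¹ = 4 := by
  rw [degree_formula_ten,
    show (Nat.divisors 1).filter (fun c ↦ Nat.Coprime c 6) = {1} from by decide, Finset.sum_singleton]
  have hh : BinQF.classNumber (-(((1 : ℕ) : ℤ) ^ 2 * 40)) = 2 := by decide +kernel
  have h8 : ZMod.χ₈ ((-40 : ℤ) : ZMod 8) = 0 := by decide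
  have h3 : legendreSym 3 (-40) = -1 := by norm_num
  rw [hh, h8, h3]
  norm_num

/-- **`deg Z(12)_ℚ = 2·Σᶠ_{[x] ∈ L(12)/O₆^×} e_x⁻¹ = 2/3`** (`4·12 = 4²·3`; the right side of `degree_formula_twelve` evaluated: `h` by kernel decision, `χ₈(−3) = -1`, `(−3∕3) = 0`). [cite: KudlaRapoportYang2006, §3.4 (3.4.4)–(3.4.6) and (3.4.14)] [cite: Cox2013, §7.B Thm. 7.7] -/
theorem degree_value_twelve :
    2 * ∑ᶠ q : (Quot (fun x y : {x : ℤ × ℤ × ℤ // x.1 ^ 2 - 3 * x.2.1 ^ 2 - 3 * x.2.2 ^ 2 = 12} ↦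
      ∃ v : ℍ[ℚ,((-1 : ℤ) : ℚ),((3 : ℤ) : ℚ)], (v ∈ order (-1) 3 ∨ v - ⟨1/2, 1/2, 1/2, -1/2⟩ ∈ order (-1) 3) ∧
        ((v * star v).re = 1 ∨ (v * star v).re = -1) ∧
        v * ⟨0, x.1.1, x.1.2.1, x.1.2.2⟩ = ⟨0, y.1.1, y.1.2.1, y.1.2.2⟩ * v)),
        ((Nat.card
          {u : ℍ[ℚ,((-1 : ℤ) : ℚ),((3 : ℤ) : ℚ)] // (u ∈ order (-1) 3 ∨ u - ⟨1/2, 1/2, 1/2, -1/2⟩ ∈ order (-1) 3) ∧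
            ((u * star u).re = 1 ∨ (u * star u).re = -1) ∧
            u * ⟨0, q.out.1.1, q.out.1.2.1, q.out.1.2.2⟩ = ⟨0, q.out.1.1, q.out.1.2.1, q.out.1.2.2⟩ * u} : ℚ))⁻¹ = 2 / 3 := by
  rw [degree_formula_twelve,
    show (Nat.divisors 4).filter (fun c ↦ Nat.Coprime c 6) = {1} from by decide, Finset.sum_singleton]
  have hh : BinQF.classNumber (-(((1 : ℕ) : ℤ) ^ 2 * 3)) = 1 := by decide +kernel
  have h8 : ZMod.χ₈ ((-3 : ℤ) : ZMod 8) = -1 := by decide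
  have h3 : legendreSym 3 (-3) = 0 := by norm_num
  rw [hh, h8, h3]
  norm_num

/-- **`deg Z(13)_ℚ = 2·Σᶠ_{[x] ∈ L(13)/O₆^×} e_x⁻¹ = 4`** (`4·13 = 1²·52`; the right side of `degree_formula_thirteen` evaluated: `h` by kernel decision, `χ₈(−52) = 0`, `(−52∕3) = -1`). [cite: KudlaRapoportYang2006, §3.4 (3.4.4)–(3.4.6) and (3.4.14)] [cite: Cox2013, §7.B Thm. 7.7] -/
theorem degree_value_thirteen :
    2 * ∑ᶠ q : (Quot (fun x y : {x : ℤ × ℤ × ℤ // x.1 ^ 2 - 3 * x.2.1 ^ 2 - 3 * x.2.2 ^ 2 = 13} ↦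
      ∃ v : ℍ[ℚ,((-1 : ℤ) : ℚ),((3 : ℤ) : ℚ)], (v ∈ order (-1) 3 ∨ v - ⟨1/2, 1/2, 1/2, -1/2⟩ ∈ order (-1) 3) ∧
        ((v * star v).re = 1 ∨ (v * star v).re = -1) ∧
        v * ⟨0, x.1.1, x.1.2.1, x.1.2.2⟩ = ⟨0, y.1.1, y.1.2.1, y.1.2.2⟩ * v)),
        ((Nat.card
          {u : ℍ[ℚ,((-1 : ℤ) : ℚ),((3 : ℤ) : ℚ)] // (u ∈ order (-1) 3 ∨ u - ⟨1/2, 1/2, 1/2, -1/2⟩ ∈ order (-1) 3) ∧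
            ((u * star u).re = 1 ∨ (u * star u).re = -1) ∧
            u * ⟨0, q.out.1.1, q.out.1.2.1, q.out.1.2.2⟩ = ⟨0, q.out.1.1, q.out.1.2.1, q.out.1.2.2⟩ * u} : ℚ))⁻¹ = 4 := by
  rw [degree_formula_thirteen,
    show (Nat.divisors 1).filter (fun c ↦ Nat.Coprime c 6) = {1} from by decide, Finset.sum_singleton]
  have hh : BinQF.classNumber (-(((1 : ℕ) : ℤ) ^ 2 * 52)) = 2 := by decide +kernel
  have h8 : ZMod.χ₈ ((-52 : ℤ) : ZMod 8) = 0 := by decide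
  have h3 : legendreSym 3 (-52) = -1 := by norm_num
  rw [hh, h8, h3]
  norm_num

/-- **`deg Z(19)_ℚ = 2·Σᶠ_{[x] ∈ L(19)/O₆^×} e_x⁻¹ = 4`** (`4·19 = 2²·19`; the right side of `degree_formula_nineteen` evaluated: `h` by kernel decision, `χ₈(−19) = -1`, `(−19∕3) = -1`). [cite: KudlaRapoportYang2006, §3.4 (3.4.4)–(3.4.6) and (3.4.14)] [cite: Cox2013, §7.B Thm. 7.7] -/
theorem degree_value_nineteen :
    2 * ∑ᶠ q : (Quot (fun x y : {x : ℤ × ℤ × ℤ // x.1 ^ 2 - 3 * x.2.1 ^ 2 - 3 * x.2.2 ^ 2 = 19} ↦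
      ∃ v : ℍ[ℚ,((-1 : ℤ) : ℚ),((3 : ℤ) : ℚ)], (v ∈ order (-1) 3 ∨ v - ⟨1/2, 1/2, 1/2, -1/2⟩ ∈ order (-1) 3) ∧
        ((v * star v).re = 1 ∨ (v * star v).re = -1) ∧
        v * ⟨0, x.1.1, x.1.2.1, x.1.2.2⟩ = ⟨0, y.1.1, y.1.2.1, y.1.2.2⟩ * v)),
        ((Nat.card
          {u : ℍ[ℚ,((-1 : ℤ) : ℚ),((3 : ℤ) : ℚ)] // (u ∈ order (-1) 3 ∨ u - ⟨1/2, 1/2, 1/2, -1/2⟩ ∈ order (-1) 3) ∧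
            ((u * star u).re = 1 ∨ (u * star u).re = -1) ∧
            u * ⟨0, q.out.1.1, q.out.1.2.1, q.out.1.2.2⟩ = ⟨0, q.out.1.1, q.out.1.2.1, q.out.1.2.2⟩ * u} : ℚ))⁻¹ = 4 := by
  rw [degree_formula_nineteen,
    show (Nat.divisors 2).filter (fun c ↦ Nat.Coprime c 6) = {1} from by decide, Finset.sum_singleton]
  have hh : BinQF.classNumber (-(((1 : ℕ) : ℤ) ^ 2 * 19)) = 1 := by decide +kernel
  have h8 : ZMod.χ₈ ((-19 : ℤ) : ZMod 8) = -1 := by decide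
  have h3 : legendreSym 3 (-19) = -1 := by norm_num
  rw [hh, h8, h3]
  norm_num

/-- **`deg Z(21)_ℚ = 2·Σᶠ_{[x] ∈ L(21)/O₆^×} e_x⁻¹ = 4`** (`4·21 = 1²·84`; the right side of `degree_formula_twentyone` evaluated: `h` by kernel decision, `χ₈(−84) = 0`, `(−84∕3) = 0`). [cite: KudlaRapoportYang2006, §3.4 (3.4.4)–(3.4.6) and (3.4.14)] [cite: Cox2013, §7.B Thm. 7.7] -/
theorem degree_value_twentyone :
    2 * ∑ᶠ q : (Quot (fun x y : {x : ℤ × ℤ × ℤ // x.1 ^ 2 - 3 * x.2.1 ^ 2 - 3 * x.2.2 ^ 2 = 21} ↦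
      ∃ v : ℍ[ℚ,((-1 : ℤ) : ℚ),((3 : ℤ) : ℚ)], (v ∈ order (-1) 3 ∨ v - ⟨1/2, 1/2, 1/2, -1/2⟩ ∈ order (-1) 3) ∧
        ((v * star v).re = 1 ∨ (v * star v).re = -1) ∧
        v * ⟨0, x.1.1, x.1.2.1, x.1.2.2⟩ = ⟨0, y.1.1, y.1.2.1, y.1.2.2⟩ * v)),
        ((Nat.card
          {u : ℍ[ℚ,((-1 : ℤ) : ℚ),((3 : ℤ) : ℚ)] // (u ∈ order (-1) 3 ∨ u - ⟨1/2, 1/2, 1/2, -1/2⟩ ∈ order (-1) 3) ∧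
            ((u * star u).re = 1 ∨ (u * star u).re = -1) ∧
            u * ⟨0, q.out.1.1, q.out.1.2.1, q.out.1.2.2⟩ = ⟨0, q.out.1.1, q.out.1.2.1, q.out.1.2.2⟩ * u} : ℚ))⁻¹ = 4 := by
  rw [degree_formula_twentyone,
    show (Nat.divisors 1).filter (fun c ↦ Nat.Coprime c 6) = {1} from by decide, Finset.sum_singleton]
  have hh : BinQF.classNumber (-(((1 : ℕ) : ℤ) ^ 2 * 84)) = 4 := by decide +kernel
  have h8 : ZMod.χ₈ ((-84 : ℤ) : ZMod 8) = 0 := by decide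
  have h3 : legendreSym 3 (-84) = 0 := by norm_num
  rw [hh, h8, h3]
  norm_num

/-- **`deg Z(22)_ℚ = 2·Σᶠ_{[x] ∈ L(22)/O₆^×} e_x⁻¹ = 4`** (`4·22 = 1²·88`; the right side of `degree_formula_twentytwo` evaluated: `h` by kernel decision, `χ₈(−88) = 0`, `(−88∕3) = -1`). [cite: KudlaRapoportYang2006, §3.4 (3.4.4)–(3.4.6) and (3.4.14)] [cite: Cox2013, §7.B Thm. 7.7] -/
theorem degree_value_twentytwo :
    2 * ∑ᶠ q : (Quot (fun x y : {x : ℤ × ℤ × ℤ // x.1 ^ 2 - 3 * x.2.1 ^ 2 - 3 * x.2.2 ^ 2 = 22} ↦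
      ∃ v : ℍ[ℚ,((-1 : ℤ) : ℚ),((3 : ℤ) : ℚ)], (v ∈ order (-1) 3 ∨ v - ⟨1/2, 1/2, 1/2, -1/2⟩ ∈ order (-1) 3) ∧
        ((v * star v).re = 1 ∨ (v * star v).re = -1) ∧
        v * ⟨0, x.1.1, x.1.2.1, x.1.2.2⟩ = ⟨0, y.1.1, y.1.2.1, y.1.2.2⟩ * v)),
        ((Nat.card
          {u : ℍ[ℚ,((-1 : ℤ) : ℚ),((3 : ℤ) : ℚ)] // (u ∈ order (-1) 3 ∨ u - ⟨1/2, 1/2, 1/2, -1/2⟩ ∈ order (-1) 3) ∧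
            ((u * star u).re = 1 ∨ (u * star u).re = -1) ∧
            u * ⟨0, q.out.1.1, q.out.1.2.1, q.out.1.2.2⟩ = ⟨0, q.out.1.1, q.out.1.2.1, q.out.1.2.2⟩ * u} : ℚ))⁻¹ = 4 := by
  rw [degree_formula_twentytwo,
    show (Nat.divisors 1).filter (fun c ↦ Nat.Coprime c 6) = {1} from by decide, Finset.sum_singleton]
  have hh : BinQF.classNumber (-(((1 : ℕ) : ℤ) ^ 2 * 88)) = 2 := by decide +kernel
  have h8 : ZMod.χ₈ ((-88 : ℤ) : ZMod 8) = 0 := by decide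
  have h3 : legendreSym 3 (-88) = -1 := by norm_num
  rw [hh, h8, h3]
  norm_num

/-- **`deg Z(24)_ℚ = 2·Σᶠ_{[x] ∈ L(24)/O₆^×} e_x⁻¹ = 2`** (`4·24 = 2²·24`; the right side of `degree_formula_twentyfour` evaluated: `h` by kernel decision, `χ₈(−24) = 0`, `(−24∕3) = 0`). [cite: KudlaRapoportYang2006, §3.4 (3.4.4)–(3.4.6) and (3.4.14)] [cite: Cox2013, §7.B Thm. 7.7] -/
theorem degree_value_twentyfour :
    2 * ∑ᶠ q : (Quot (fun x y : {x : ℤ × ℤ × ℤ // x.1 ^ 2 - 3 * x.2.1 ^ 2 - 3 * x.2.2 ^ 2 = 24} ↦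
      ∃ v : ℍ[ℚ,((-1 : ℤ) : ℚ),((3 : ℤ) : ℚ)], (v ∈ order (-1) 3 ∨ v - ⟨1/2, 1/2, 1/2, -1/2⟩ ∈ order (-1) 3) ∧
        ((v * star v).re = 1 ∨ (v * star v).re = -1) ∧
        v * ⟨0, x.1.1, x.1.2.1, x.1.2.2⟩ = ⟨0, y.1.1, y.1.2.1, y.1.2.2⟩ * v)),
        ((Nat.card
          {u : ℍ[ℚ,((-1 : ℤ) : ℚ),((3 : ℤ) : ℚ)] // (u ∈ order (-1) 3 ∨ u - ⟨1/2, 1/2, 1/2, -1/2⟩ ∈ order (-1) 3) ∧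
            ((u * star u).re = 1 ∨ (u * star u).re = -1) ∧
            u * ⟨0, q.out.1.1, q.out.1.2.1, q.out.1.2.2⟩ = ⟨0, q.out.1.1, q.out.1.2.1, q.out.1.2.2⟩ * u} : ℚ))⁻¹ = 2 := by
  rw [degree_formula_twentyfour,
    show (Nat.divisors 2).filter (fun c ↦ Nat.Coprime c 6) = {1} from by decide, Finset.sum_singleton]
  have hh : BinQF.classNumber (-(((1 : ℕ) : ℤ) ^ 2 * 24)) = 2 := by decide +kernel
  have h8 : ZMod.χ₈ ((-24 : ℤ) : ZMod 8) = 0 := by decide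
  have h3 : legendreSym 3 (-24) = 0 := by norm_num
  rw [hh, h8, h3]
  norm_num

/-- **`deg Z(25)_ℚ = 2·Σᶠ_{[x] ∈ L(25)/O₆^×} e_x⁻¹ = 5`** (`4·25 = 5²·4`; the right side of `degree_formula_twentyfive` evaluated: `h` by kernel decision, `χ₈(−4) = 0`, `(−4∕3) = -1`). [cite: KudlaRapoportYang2006, §3.4 (3.4.4)–(3.4.6) and (3.4.14)] [cite: Cox2013, §7.B Thm. 7.7] -/
theorem degree_value_twentyfive :
    2 * ∑ᶠ q : (Quot (fun x y : {x : ℤ × ℤ × ℤ // x.1 ^ 2 - 3 * x.2.1 ^ 2 - 3 * x.2.2 ^ 2 = 25} ↦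
      ∃ v : ℍ[ℚ,((-1 : ℤ) : ℚ),((3 : ℤ) : ℚ)], (v ∈ order (-1) 3 ∨ v - ⟨1/2, 1/2, 1/2, -1/2⟩ ∈ order (-1) 3) ∧
        ((v * star v).re = 1 ∨ (v * star v).re = -1) ∧
        v * ⟨0, x.1.1, x.1.2.1, x.1.2.2⟩ = ⟨0, y.1.1, y.1.2.1, y.1.2.2⟩ * v)),
        ((Nat.card
          {u : ℍ[ℚ,((-1 : ℤ) : ℚ),((3 : ℤ) : ℚ)] // (u ∈ order (-1) 3 ∨ u - ⟨1/2, 1/2, 1/2, -1/2⟩ ∈ order (-1) 3) ∧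
            ((u * star u).re = 1 ∨ (u * star u).re = -1) ∧
            u * ⟨0, q.out.1.1, q.out.1.2.1, q.out.1.2.2⟩ = ⟨0, q.out.1.1, q.out.1.2.1, q.out.1.2.2⟩ * u} : ℚ))⁻¹ = 5 := by
  rw [degree_formula_twentyfive,
    show (Nat.divisors 5).filter (fun c ↦ Nat.Coprime c 6) = {1, 5} from by decide, Finset.sum_pair (by norm_num)]
  have hh : BinQF.classNumber (-(((1 : ℕ) : ℤ) ^ 2 * 4)) = 1 := by decide +kernel
  have hh5 : BinQF.classNumber (-(((5 : ℕ) : ℤ) ^ 2 * 4)) = 2 := by decide +kernel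
  have h8 : ZMod.χ₈ ((-4 : ℤ) : ZMod 8) = 0 := by decide
  have h3 : legendreSym 3 (-4) = -1 := by norm_num
  rw [hh, hh5, h8, h3]
  norm_num

/-- **`deg Z(36)_ℚ = 2·Σᶠ_{[x] ∈ L(36)/O₆^×} e_x⁻¹ = 1`** (`4·36 = 6²·4`; the right side of `degree_formula_thirtysix` evaluated: `h` by kernel decision, `χ₈(−4) = 0`, `(−4∕3) = -1`). [cite: KudlaRapoportYang2006, §3.4 (3.4.4)–(3.4.6) and (3.4.14)] [cite: Cox2013, §7.B Thm. 7.7] -/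
theorem degree_value_thirtysix :
    2 * ∑ᶠ q : (Quot (fun x y : {x : ℤ × ℤ × ℤ // x.1 ^ 2 - 3 * x.2.1 ^ 2 - 3 * x.2.2 ^ 2 = 36} ↦
      ∃ v : ℍ[ℚ,((-1 : ℤ) : ℚ),((3 : ℤ) : ℚ)], (v ∈ order (-1) 3 ∨ v - ⟨1/2, 1/2, 1/2, -1/2⟩ ∈ order (-1) 3) ∧
        ((v * star v).re = 1 ∨ (v * star v).re = -1) ∧
        v * ⟨0, x.1.1, x.1.2.1, x.1.2.2⟩ = ⟨0, y.1.1, y.1.2.1, y.1.2.2⟩ * v)),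
        ((Nat.card
          {u : ℍ[ℚ,((-1 : ℤ) : ℚ),((3 : ℤ) : ℚ)] // (u ∈ order (-1) 3 ∨ u - ⟨1/2, 1/2, 1/2, -1/2⟩ ∈ order (-1) 3) ∧
            ((u * star u).re = 1 ∨ (u * star u).re = -1) ∧
            u * ⟨0, q.out.1.1, q.out.1.2.1, q.out.1.2.2⟩ = ⟨0, q.out.1.1, q.out.1.2.1, q.out.1.2.2⟩ * u} : ℚ))⁻¹ = 1 := by
  rw [degree_formula_thirtysix,
    show (Nat.divisors 6).filter (fun c ↦ Nat.Coprime c 6) = {1} from by decide, Finset.sum_singleton]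
  have hh : BinQF.classNumber (-(((1 : ℕ) : ℤ) ^ 2 * 4)) = 1 := by decide +kernel
  have h8 : ZMod.χ₈ ((-4 : ℤ) : ZMod 8) = 0 := by decide
  have h3 : legendreSym 3 (-4) = -1 := by norm_num
  rw [hh, h8, h3]
  norm_num

/-- **`deg Z(75)_ℚ = 2·Σᶠ_{[x] ∈ L(75)/O₆^×} e_x⁻¹ = 14/3`** (`4·75 = 10²·3`; the right side of `degree_formula_seventyfive` evaluated: `h` by kernel decision, `χ₈(−3) = -1`, `(−3∕3) = 0`). [cite: KudlaRapoportYang2006, §3.4 (3.4.4)–(3.4.6) and (3.4.14)] [cite: Cox2013, §7.B Thm. 7.7] -/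
theorem degree_value_seventyfive :
    2 * ∑ᶠ q : (Quot (fun x y : {x : ℤ × ℤ × ℤ // x.1 ^ 2 - 3 * x.2.1 ^ 2 - 3 * x.2.2 ^ 2 = 75} ↦
      ∃ v : ℍ[ℚ,((-1 : ℤ) : ℚ),((3 : ℤ) : ℚ)], (v ∈ order (-1) 3 ∨ v - ⟨1/2, 1/2, 1/2, -1/2⟩ ∈ order (-1) 3) ∧
        ((v * star v).re = 1 ∨ (v * star v).re = -1) ∧
        v * ⟨0, x.1.1, x.1.2.1, x.1.2.2⟩ = ⟨0, y.1.1, y.1.2.1, y.1.2.2⟩ * v)),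
        ((Nat.card
          {u : ℍ[ℚ,((-1 : ℤ) : ℚ),((3 : ℤ) : ℚ)] // (u ∈ order (-1) 3 ∨ u - ⟨1/2, 1/2, 1/2, -1/2⟩ ∈ order (-1) 3) ∧
            ((u * star u).re = 1 ∨ (u * star u).re = -1) ∧
            u * ⟨0, q.out.1.1, q.out.1.2.1, q.out.1.2.2⟩ = ⟨0, q.out.1.1, q.out.1.2.1, q.out.1.2.2⟩ * u} : ℚ))⁻¹ = 14 / 3 := by
  rw [degree_formula_seventyfive,
    show (Nat.divisors 10).filter (fun c ↦ Nat.Coprime c 6) = {1, 5} from by decide, Finset.sum_pair (by norm_num)]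
  have hh : BinQF.classNumber (-(((1 : ℕ) : ℤ) ^ 2 * 3)) = 1 := by decide +kernel
  have hh5 : BinQF.classNumber (-(((5 : ℕ) : ℤ) ^ 2 * 3)) = 2 := by decide +kernel
  have h8 : ZMod.χ₈ ((-3 : ℤ) : ZMod 8) = -1 := by decide
  have h3 : legendreSym 3 (-3) = 0 := by norm_num
  rw [hh, hh5, h8, h3]
  norm_num

/-- **`deg Z(100)_ℚ = 2·Σᶠ_{[x] ∈ L(100)/O₆^×} e_x⁻¹ = 5`** (`4·100 = 10²·4`; the right side of `degree_formula_hundred` evaluated: `h` by kernel decision, `χ₈(−4) = 0`, `(−4∕3) = -1`). [cite: KudlaRapoportYang2006, §3.4 (3.4.4)–(3.4.6) and (3.4.14)] [cite: Cox2013, §7.B Thm. 7.7] -/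
theorem degree_value_hundred :
    2 * ∑ᶠ q : (Quot (fun x y : {x : ℤ × ℤ × ℤ // x.1 ^ 2 - 3 * x.2.1 ^ 2 - 3 * x.2.2 ^ 2 = 100} ↦
      ∃ v : ℍ[ℚ,((-1 : ℤ) : ℚ),((3 : ℤ) : ℚ)], (v ∈ order (-1) 3 ∨ v - ⟨1/2, 1/2, 1/2, -1/2⟩ ∈ order (-1) 3) ∧
        ((v * star v).re = 1 ∨ (v * star v).re = -1) ∧
        v * ⟨0, x.1.1, x.1.2.1, x.1.2.2⟩ = ⟨0, y.1.1, y.1.2.1, y.1.2.2⟩ * v)),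
        ((Nat.card
          {u : ℍ[ℚ,((-1 : ℤ) : ℚ),((3 : ℤ) : ℚ)] // (u ∈ order (-1) 3 ∨ u - ⟨1/2, 1/2, 1/2, -1/2⟩ ∈ order (-1) 3) ∧
            ((u * star u).re = 1 ∨ (u * star u).re = -1) ∧
            u * ⟨0, q.out.1.1, q.out.1.2.1, q.out.1.2.2⟩ = ⟨0, q.out.1.1, q.out.1.2.1, q.out.1.2.2⟩ * u} : ℚ))⁻¹ = 5 := by
  rw [degree_formula_hundred,
    show (Nat.divisors 10).filter (fun c ↦ Nat.Coprime c 6) = {1, 5} from by decide, Finset.sum_pair (by norm_num)]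
  have hh : BinQF.classNumber (-(((1 : ℕ) : ℤ) ^ 2 * 4)) = 1 := by decide +kernel
  have hh5 : BinQF.classNumber (-(((5 : ℕ) : ℤ) ^ 2 * 4)) = 2 := by decide +kernel
  have h8 : ZMod.χ₈ ((-4 : ℤ) : ZMod 8) = 0 := by decide
  have h3 : legendreSym 3 (-4) = -1 := by norm_num
  rw [hh, hh5, h8, h3]
  norm_num

end Values

end Literature.Geometry.Kaehler.ComplexTorus.QuaternionType
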